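import Mathlib
import Summits.NavierStokesRegularity.NavierStokesRegularity.Theorems.FilamentSkeletonRssAreaLawSlavingGrowth

/-!
# Area-law slaving, part 6 — UNIQUENESS of the regular core area (the slaving `w ↦ Aa` is a function)
# (`FilamentSkeletonRss`, child crux `TangentSkeletonNearStraight`, stmt-NavierStokesRegularity-28295, line
# `child_tangent_analytic_strip`, ∃-side of the registered stub `stub_analyticClosing`, step (v))

Part 2 constructed, for a slip `w` with a transversal supercritical zero `c`, a positive differentiable solution of the AREA LAW
`w·A′ = (3/2 − w′)·A + 4` on all of `ℝ`.  This file shows it is THE ONLY ONE: two differentiable positive solutions coincide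
(`areaLaw_solution_unique`).  Hence in the Newton scheme of the line the core areas are a genuine FUNCTION of the curve/slip
unknowns (no free parameters in the area block: the homogeneous solutions `∼ |τ − c|^{3/(2w′(c)) − 1}` are singular at the zero).

Mechanism (no integration, no real powers).  For two solutions, `D = A₁ − A₂` has `D(c) = 0` (the law at `c` pins
`A_i(c) = 4/(w′(c) − 3/2)`), and `E = w·D` satisfies `E′ = (3/2)·D` everywhere.
* §1 CORE WINDOW (`areaLaw_unique_window_right`): where `w(τ) ≥ (3/2)(τ − c)` (the supercritical window), `Ψ = E²/(τ−c)²` has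
  `Ψ′ = 2wD²((3/2)(τ−c) − w)/(τ−c)³ ≤ 0`, and `Ψ(σ) = (w(σ)/(σ−c))²D(σ)² ≤ Λ²D(σ)² → 0` as `σ → c⁺`; an antitone non-negative
  function with limit `0` at the left end vanishes: `D ≡ 0` on the window.
* §2 ARM (`areaLaw_unique_arm_right`): where `w ≥ wmin > 0`, `E²·e^{−3τ/wmin}` is antitone (`(E²)′ = 3E²/w`), so a zero of `E`
  propagates to the right.
* §3 two-sided assembly by the reflection symmetry of part 3 (`areaLaw_solution_unique`), under the hypotheses of the package of
  part 5 (window supercriticality `w′ ≥ 3/2 + δ` on `|τ−c| ≤ S₀`, `|w′| ≤ Λ`, slip floor `m|τ−c| ≤ |w|`).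

HONEST FRAMING: elementary ODE analysis serving a HYPOTHETICAL filament skeleton on the NEGATIVE side of a MODEL route (A1G aside);
nothing here bears on Navier–Stokes regularity or blow-up, and no registered stub is closed by this file.
`--supports stmt-NavierStokesRegularity-28295`.
-/

set_option linter.dupNamespace false

noncomputable section

namespace Summit.NavierStokesRegularity.NavierStokesRegularity.Theorems.AreaLawSlaving

open Set Real
open Summit.NavierStokesRegularity.NavierStokesRegularity.Theorems.SkeletonJ1NormalBlockWindow
open Summit.NavierStokesRegularity.NavierStokesRegularity.Theorems.SkeletonJ1NormalBlockCeiling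

/-! ## §0 The difference of two solutions -/

/-- Two solutions of the area law agree AT the zero of the slip: `A₁(c) = A₂(c)` (both equal `4/(w′(c) − 3/2)`). [folklore] -/
theorem areaLaw_eq_at_zero {w A₁ A₂ : ℝ → ℝ} {c : ℝ}
    (h₁ : ∀ τ, w τ * deriv A₁ τ = (3 / 2 - deriv w τ) * A₁ τ + 4)
    (h₂ : ∀ τ, w τ * deriv A₂ τ = (3 / 2 - deriv w τ) * A₂ τ + 4) (hc : w c = 0) : A₁ c = A₂ c := by
  have e₁ := h₁ c
  have e₂ := h₂ c
  rw [hc, zero_mul] at e₁ e₂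
  have hne : 3 / 2 - deriv w c ≠ 0 := by
    intro h0; rw [h0, zero_mul, zero_add] at e₁; norm_num at e₁
  have : (3 / 2 - deriv w c) * (A₁ c - A₂ c) = 0 := by linarith
  rcases mul_eq_zero.1 this with h | h
  · exact absurd h hne
  · linarith

/-- For two solutions, `E = w·(A₁ − A₂)` has derivative `(3/2)·(A₁ − A₂)` everywhere. [folklore] -/
theorem areaLaw_diff_hasDerivAt {w A₁ A₂ : ℝ → ℝ} (hw : Differentiable ℝ w) (hA₁ : Differentiable ℝ A₁)
    (hA₂ : Differentiable ℝ A₂) (h₁ : ∀ τ, w τ * deriv A₁ τ = (3 / 2 - deriv w τ) * A₁ τ + 4)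
    (h₂ : ∀ τ, w τ * deriv A₂ τ = (3 / 2 - deriv w τ) * A₂ τ + 4) (τ : ℝ) :
    HasDerivAt (fun s => w s * (A₁ s - A₂ s)) (3 / 2 * (A₁ τ - A₂ τ)) τ := by
  have h := (areaLaw_hasDerivAt_mul hw hA₁ h₁ τ).sub (areaLaw_hasDerivAt_mul hw hA₂ h₂ τ)
  have heq : (fun s => w s * (A₁ s - A₂ s)) = fun s => w s * A₁ s - w s * A₂ s := by funext s; ring
  rw [heq]
  exact h.congr_deriv (by ring)

/-! ## §1 Uniqueness on the core window -/

/-- **Uniqueness on the (right) core window.**  If `w(c) = 0`, `|w′| ≤ Λ`, `w(s) ≥ (3/2)(s − c)` for `s ∈ [c, c+r]`, and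
`A₁, A₂` are differentiable solutions of the area law, then `A₁ = A₂` on `[c, c + r]`. [folklore] -/
theorem areaLaw_unique_window_right {w A₁ A₂ : ℝ → ℝ} {c r Λ : ℝ} (hw : Differentiable ℝ w)
    (hA₁ : Differentiable ℝ A₁) (hA₂ : Differentiable ℝ A₂)
    (h₁ : ∀ τ, w τ * deriv A₁ τ = (3 / 2 - deriv w τ) * A₁ τ + 4)
    (h₂ : ∀ τ, w τ * deriv A₂ τ = (3 / 2 - deriv w τ) * A₂ τ + 4) (hc : w c = 0) (hΛ : ∀ τ, |deriv w τ| ≤ Λ)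
    (hwin : ∀ s, c ≤ s → s ≤ c + r → 3 / 2 * (s - c) ≤ w s) {τ : ℝ} (hτ : c ≤ τ) (hτr : τ ≤ c + r) :
    A₁ τ = A₂ τ := by
  rcases hτ.eq_or_lt with h | hτ'
  · rw [← h]; exact areaLaw_eq_at_zero h₁ h₂ hc
  -- notation
  set D : ℝ → ℝ := fun s => A₁ s - A₂ s with hD
  have hDc : D c = 0 := by rw [hD]; simp only; rw [areaLaw_eq_at_zero h₁ h₂ hc, sub_self]
  have hE : ∀ s, HasDerivAt (fun s => w s * D s) (3 / 2 * D s) s := fun s =>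
    areaLaw_diff_hasDerivAt hw hA₁ hA₂ h₁ h₂ s
  -- Ψ = (w D)² / (s - c)² is antitone on (c, c + r]
  have hΨd : ∀ s, c < s → HasDerivAt (fun s => (w s * D s) ^ 2 / (s - c) ^ 2)
      ((2 * (w s * D s) * (3 / 2 * D s) * (s - c) ^ 2 - (w s * D s) ^ 2 * (2 * (s - c))) / ((s - c) ^ 2) ^ 2) s := by
    intro s hs
    have hsc : (s - c) ^ 2 ≠ 0 := pow_ne_zero 2 (sub_pos.2 hs).ne'
    have hn : HasDerivAt (fun s => (w s * D s) ^ 2) (2 * (w s * D s) * (3 / 2 * D s)) s := by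
      have := (hE s).fun_pow 2
      exact this.congr_deriv (by ring)
    have hd : HasDerivAt (fun s => (s - c) ^ 2) (2 * (s - c)) s := by
      have := ((hasDerivAt_id' s).sub_const c).fun_pow 2
      exact this.congr_deriv (by simp)
    exact hn.div hd hsc
  have hanti : AntitoneOn (fun s => (w s * D s) ^ 2 / (s - c) ^ 2) (Ioc c (c + r)) := by
    apply antitoneOn_of_deriv_nonpos (convex_Ioc c (c + r))
    · exact HasDerivAt.continuousOn fun s hs => hΨd s hs.1
    · intro s hs
      rw [interior_Ioc] at hs
      exact (hΨd s hs.1).differentiableAt.differentiableWithinAt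
    · intro s hs
      rw [interior_Ioc] at hs
      rw [(hΨd s hs.1).deriv]
      have hsc : 0 < s - c := sub_pos.2 hs.1
      have hws : 3 / 2 * (s - c) ≤ w s := hwin s hs.1.le hs.2.le
      have hnum : 2 * (w s * D s) * (3 / 2 * D s) * (s - c) ^ 2 - (w s * D s) ^ 2 * (2 * (s - c)) =
          2 * (s - c) * w s * D s ^ 2 * (3 / 2 * (s - c) - w s) := by ring
      rw [hnum]
      apply div_nonpos_of_nonpos_of_nonneg _ (by positivity)
      have h1 : 0 ≤ 2 * (s - c) * w s * D s ^ 2 := by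
        have : 0 ≤ w s := le_trans (by positivity) hws
        positivity
      exact mul_nonpos_of_nonneg_of_nonpos h1 (by linarith)
  -- Ψ(σ) ≤ Λ² D(σ)² → 0 as σ → c⁺, hence Ψ(τ) ≤ ε for every ε > 0
  have hΨτ_le : ∀ ε, 0 < ε → (w τ * D τ) ^ 2 / (τ - c) ^ 2 ≤ ε := by
    intro ε hε
    -- continuity of D at c
    have hDcont : ContinuousAt D c := ((hA₁ c).sub (hA₂ c)).continuousAt
    have hΛ0 : 0 ≤ Λ := le_trans (abs_nonneg _) (hΛ c)
    obtain ⟨η, hη, hηD⟩ : ∃ η > 0, ∀ s, |s - c| < η → (Λ ^ 2 + 1) * D s ^ 2 < ε := by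
      have hct : ContinuousAt (fun s => (Λ ^ 2 + 1) * D s ^ 2) c := (hDcont.pow 2).const_mul _
      have h0 : (fun s => (Λ ^ 2 + 1) * D s ^ 2) c < ε := by simp only [hDc]; simpa using hε
      have hev := hct.eventually (gt_mem_nhds h0)
      obtain ⟨η, hη, hball⟩ := Metric.eventually_nhds_iff.1 hev
      exact ⟨η, hη, fun s hs => hball (by rw [Real.dist_eq]; exact hs)⟩
    -- pick σ ∈ (c, τ] with σ - c < η
    set σ : ℝ := c + min (η / 2) (τ - c) with hσ
    have hσc : c < σ := by rw [hσ]; have : 0 < min (η / 2) (τ - c) := lt_min (by linarith) (sub_pos.2 hτ'); linarith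
    have hστ : σ ≤ τ := by rw [hσ]; have := min_le_right (η / 2) (τ - c); linarith
    have hση : |σ - c| < η := by
      rw [abs_of_pos (sub_pos.2 hσc), hσ]; have := min_le_left (η / 2) (τ - c); linarith
    have hmono := hanti ⟨hσc, hστ.trans hτr⟩ ⟨hτ', hτr⟩ hστ
    -- Ψ σ ≤ Λ² D(σ)²
    have hwσ : |w σ| ≤ Λ * |σ - c| := slip_abs_le_of_deriv_bound hw hc hΛ σ
    have hσpos : 0 < σ - c := sub_pos.2 hσc
    have hΨσ : (w σ * D σ) ^ 2 / (σ - c) ^ 2 ≤ Λ ^ 2 * D σ ^ 2 := by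
      rw [div_le_iff₀ (pow_pos hσpos 2), mul_pow]
      have h1 : w σ ^ 2 ≤ (Λ * |σ - c|) ^ 2 := by
        rw [← sq_abs (w σ)]; exact pow_le_pow_left₀ (abs_nonneg _) hwσ 2
      rw [mul_pow, sq_abs] at h1
      nlinarith [sq_nonneg (D σ)]
    have hfin : Λ ^ 2 * D σ ^ 2 ≤ ε := by nlinarith [hηD σ hση, sq_nonneg (D σ)]
    exact hmono.trans (hΨσ.trans hfin)
  have hΨ0 : (w τ * D τ) ^ 2 / (τ - c) ^ 2 ≤ 0 := by
    by_contra hpos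
    push Not at hpos
    have := hΨτ_le ((w τ * D τ) ^ 2 / (τ - c) ^ 2 / 2) (by positivity)
    linarith
  have hτc : 0 < τ - c := sub_pos.2 hτ'
  have hΨnn : 0 ≤ (w τ * D τ) ^ 2 / (τ - c) ^ 2 := by positivity
  have hzero : (w τ * D τ) ^ 2 = 0 := by
    have := le_antisymm hΨ0 hΨnn
    rwa [div_eq_zero_iff, or_iff_left (pow_ne_zero 2 hτc.ne')] at this
  have hwτ : 0 < w τ := lt_of_lt_of_le (by positivity) (hwin τ hτ hτr)
  have : D τ = 0 := by
    have h := pow_eq_zero_iff (n := 2) (by norm_num) |>.1 hzero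
    rcases mul_eq_zero.1 h with h | h
    · exact absurd h hwτ.ne'
    · exact h
  have : A₁ τ - A₂ τ = 0 := this
  linarith

/-! ## §2 Uniqueness along an arm where the slip is bounded below -/

/-- **Propagation along the (right) arm.**  If `w ≥ wmin > 0` on `[s₀, ∞)` and two differentiable solutions agree at `s₀`,
they agree on `[s₀, ∞)` (`E²e^{−3τ/wmin}` is antitone, `E = w(A₁ − A₂)`). [folklore] -/
theorem areaLaw_unique_arm_right {w A₁ A₂ : ℝ → ℝ} {s₀ wmin : ℝ} (hw : Differentiable ℝ w)
    (hA₁ : Differentiable ℝ A₁) (hA₂ : Differentiable ℝ A₂)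
    (h₁ : ∀ τ, w τ * deriv A₁ τ = (3 / 2 - deriv w τ) * A₁ τ + 4)
    (h₂ : ∀ τ, w τ * deriv A₂ τ = (3 / 2 - deriv w τ) * A₂ τ + 4) (hwmin : 0 < wmin)
    (hws : ∀ s, s₀ ≤ s → wmin ≤ w s) (h0 : A₁ s₀ = A₂ s₀) {τ : ℝ} (hτ : s₀ ≤ τ) : A₁ τ = A₂ τ := by
  set D : ℝ → ℝ := fun s => A₁ s - A₂ s with hD
  have hE : ∀ s, HasDerivAt (fun s => w s * D s) (3 / 2 * D s) s := fun s =>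
    areaLaw_diff_hasDerivAt hw hA₁ hA₂ h₁ h₂ s
  have hΦd : ∀ s, HasDerivAt (fun s => (w s * D s) ^ 2 * Real.exp (-(3 / wmin) * s))
      (2 * (w s * D s) * (3 / 2 * D s) * Real.exp (-(3 / wmin) * s) +
        (w s * D s) ^ 2 * (Real.exp (-(3 / wmin) * s) * (-(3 / wmin)))) s := by
    intro s
    have hn : HasDerivAt (fun s => (w s * D s) ^ 2) (2 * (w s * D s) * (3 / 2 * D s)) s := by
      have := (hE s).fun_pow 2
      exact this.congr_deriv (by ring)
    have he : HasDerivAt (fun s => Real.exp (-(3 / wmin) * s)) (Real.exp (-(3 / wmin) * s) * (-(3 / wmin))) s := by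
      have := ((hasDerivAt_id' s).const_mul (-(3 / wmin))).exp
      simpa using this
    exact hn.mul he
  have hanti : AntitoneOn (fun s => (w s * D s) ^ 2 * Real.exp (-(3 / wmin) * s)) (Ici s₀) := by
    apply antitoneOn_of_deriv_nonpos (convex_Ici s₀)
    · exact HasDerivAt.continuousOn fun s _ => hΦd s
    · exact fun s _ => (hΦd s).differentiableAt.differentiableWithinAt
    · intro s hs
      rw [interior_Ici] at hs
      rw [(hΦd s).deriv]
      have hwle : wmin ≤ w s := hws s (le_of_lt hs)
      have hwpos : 0 < w s := hwmin.trans_le hwle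
      have hexp : 0 < Real.exp (-(3 / wmin) * s) := Real.exp_pos _
      have hnum : 2 * (w s * D s) * (3 / 2 * D s) * Real.exp (-(3 / wmin) * s) +
          (w s * D s) ^ 2 * (Real.exp (-(3 / wmin) * s) * -(3 / wmin)) =
          3 * Real.exp (-(3 / wmin) * s) * (w s * D s ^ 2) * (1 - w s / wmin) := by
        field_simp
        ring
      rw [hnum]
      have h1 : 0 ≤ 3 * Real.exp (-(3 / wmin) * s) * (w s * D s ^ 2) := by positivity
      have h2 : 1 - w s / wmin ≤ 0 := by rw [sub_nonpos, le_div_iff₀ hwmin, one_mul]; exact hwle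
      exact mul_nonpos_of_nonneg_of_nonpos h1 h2
  have h := hanti (self_mem_Ici (a := s₀)) (mem_Ici.2 hτ) hτ
  simp only at h
  have hD0 : D s₀ = 0 := by rw [hD]; simp only; rw [h0, sub_self]
  rw [hD0, mul_zero] at h
  simp only [ne_eq, OfNat.ofNat_ne_zero, not_false_eq_true, zero_pow, zero_mul] at h
  have hexp : 0 < Real.exp (-(3 / wmin) * τ) := Real.exp_pos _
  have hsq : (w τ * D τ) ^ 2 ≤ 0 := by
    have := (mul_nonpos_iff.1 h)
    rcases this with ⟨_, h2⟩ | ⟨h1, _⟩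
    · exact absurd h2 (not_le.2 hexp)
    · exact h1
  have hzero : w τ * D τ = 0 := by
    have := le_antisymm hsq (sq_nonneg _)
    exact pow_eq_zero_iff (n := 2) (by norm_num) |>.1 this
  have hwτ : 0 < w τ := hwmin.trans_le (hws τ hτ)
  rcases mul_eq_zero.1 hzero with h | h
  · exact absurd h hwτ.ne'
  · have : A₁ τ - A₂ τ = 0 := h
    linarith

/-! ## §3 Global uniqueness -/

/-- **Right-half uniqueness.**  `w(c) = 0`, `|w′| ≤ Λ`, core-window supercriticality `w′ ≥ 3/2 + δ` on `|τ − c| ≤ S₀`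
(`δ ≥ 0`, `S₀ > 0`), slip floor `m(τ − c) ≤ w(τ)` for `τ ≥ c` (`m > 0`): two differentiable solutions agree on `[c, ∞)`.
[folklore] -/
theorem areaLaw_unique_right {w A₁ A₂ : ℝ → ℝ} {c S₀ Λ δ m : ℝ} (hw : Differentiable ℝ w)
    (hA₁ : Differentiable ℝ A₁) (hA₂ : Differentiable ℝ A₂)
    (h₁ : ∀ τ, w τ * deriv A₁ τ = (3 / 2 - deriv w τ) * A₁ τ + 4)
    (h₂ : ∀ τ, w τ * deriv A₂ τ = (3 / 2 - deriv w τ) * A₂ τ + 4) (hc : w c = 0) (hΛ : ∀ τ, |deriv w τ| ≤ Λ)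
    (hδ : 0 ≤ δ) (hS₀ : 0 < S₀) (hsup : ∀ s, |s - c| ≤ S₀ → 3 / 2 + δ ≤ deriv w s)
    (hm : 0 < m) (hfloor : ∀ τ, c ≤ τ → m * (τ - c) ≤ w τ) {τ : ℝ} (hτ : c ≤ τ) : A₁ τ = A₂ τ := by
  -- window
  have hwin : ∀ s, c ≤ s → s ≤ c + S₀ → 3 / 2 * (s - c) ≤ w s := by
    intro s hs hsr
    have h := slip_ge_linear_of_supercritical hw hc hsup hs (by linarith)
    nlinarith
  by_cases hτS : τ ≤ c + S₀
  · exact areaLaw_unique_window_right hw hA₁ hA₂ h₁ h₂ hc hΛ hwin hτ hτS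
  · push Not at hτS
    have h0 : A₁ (c + S₀) = A₂ (c + S₀) :=
      areaLaw_unique_window_right hw hA₁ hA₂ h₁ h₂ hc hΛ hwin (by linarith) le_rfl
    have hws : ∀ s, c + S₀ ≤ s → m * S₀ ≤ w s := by
      intro s hs
      have := hfloor s (by linarith)
      have h2 : m * S₀ ≤ m * (s - c) := mul_le_mul_of_nonneg_left (by linarith) hm.le
      linarith
    exact areaLaw_unique_arm_right hw hA₁ hA₂ h₁ h₂ (mul_pos hm hS₀) hws h0 hτS.le

/-- **UNIQUENESS OF THE SLAVED AREA.**  Under the slip hypotheses of the package (`w(c) = 0`, `|w′| ≤ Λ`, core-window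
supercriticality `w′ ≥ 3/2 + δ` on `|τ−c| ≤ S₀`, slip floor `m|τ − c| ≤ |w|`), two POSITIVE differentiable solutions of the area
law coincide on all of `ℝ`.  In particular the area of part 2 / part 5 is the unique one. [folklore] -/
theorem areaLaw_solution_unique {w A₁ A₂ : ℝ → ℝ} {c S₀ Λ δ m : ℝ} (hw : Differentiable ℝ w)
    (hA₁ : Differentiable ℝ A₁) (hA₂ : Differentiable ℝ A₂)
    (h₁ : ∀ τ, w τ * deriv A₁ τ = (3 / 2 - deriv w τ) * A₁ τ + 4)
    (h₂ : ∀ τ, w τ * deriv A₂ τ = (3 / 2 - deriv w τ) * A₂ τ + 4)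
    (hpos₁ : ∀ τ, 0 < A₁ τ) (hc : w c = 0) (hΛ : ∀ τ, |deriv w τ| ≤ Λ)
    (hδ : 0 ≤ δ) (hS₀ : 0 < S₀) (hsup : ∀ s, |s - c| ≤ S₀ → 3 / 2 + δ ≤ deriv w s)
    (hm : 0 < m) (hfloor : ∀ τ, m * |τ - c| ≤ |w τ|) : A₁ = A₂ := by
  have hwpos : ∀ x, c < x → 0 < w x := fun x hx => areaLaw_pos_of_lt hw hA₁ h₁ hpos₁ hc hx
  have hwneg : ∀ x, x < c → w x < 0 := fun x hx => areaLaw_neg_of_lt hw hA₁ h₁ hpos₁ hc hx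
  -- one-sided floors
  have hfloorR : ∀ x, c ≤ x → m * (x - c) ≤ w x := by
    intro x hx
    rcases hx.eq_or_lt with h | h
    · rw [← h, hc, sub_self, mul_zero]
    · have h1 := hfloor x
      rw [abs_of_pos (sub_pos.2 h), abs_of_pos (hwpos x h)] at h1
      exact h1
  funext τ
  rcases le_total c τ with hτ | hτ
  · exact areaLaw_unique_right hw hA₁ hA₂ h₁ h₂ hc hΛ hδ hS₀ hsup hm hfloorR hτ
  · -- reflect
    have hw' := differentiable_reflect_neg hw c
    have hA₁' := differentiable_reflect hA₁ c
    have hA₂' := differentiable_reflect hA₂ c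
    have h₁' := areaLaw_reflect (c := c) h₁
    have h₂' := areaLaw_reflect (c := c) h₂
    have hc' : (fun x => -w (2 * c - x)) c = 0 := by
      show -w (2 * c - c) = 0
      rw [show 2 * c - c = c by ring, hc, neg_zero]
    have hΛ' : ∀ x, |deriv (fun x => -w (2 * c - x)) x| ≤ Λ := fun x => by rw [deriv_reflect_neg]; exact hΛ _
    have hsup' : ∀ s, |s - c| ≤ S₀ → 3 / 2 + δ ≤ deriv (fun x => -w (2 * c - x)) s := by
      intro s hs
      rw [deriv_reflect_neg]
      exact hsup _ (by rw [show 2 * c - s - c = -(s - c) by ring, abs_neg]; exact hs)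
    have hfloor' : ∀ x, c ≤ x → m * (x - c) ≤ (fun x => -w (2 * c - x)) x := by
      intro x hx
      rcases hx.eq_or_lt with h | h
      · rw [← h]
        show m * (c - c) ≤ -w (2 * c - c)
        rw [sub_self, mul_zero, show 2 * c - c = c by ring, hc, neg_zero]
      · have h1 := hfloor (2 * c - x)
        have hlt : 2 * c - x < c := by linarith
        rw [show 2 * c - x - c = -(x - c) by ring, abs_neg, abs_of_pos (sub_pos.2 h),
          abs_of_neg (hwneg _ hlt)] at h1
        exact h1
    have h := areaLaw_unique_right hw' hA₁' hA₂' h₁' h₂' hc' hΛ' hδ hS₀ hsup' hm hfloor'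
      (show c ≤ 2 * c - τ by linarith)
    simp only [show 2 * c - (2 * c - τ) = τ by ring] at h
    exact h

end Summit.NavierStokesRegularity.NavierStokesRegularity.Theorems.AreaLawSlaving

end
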